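import Mathlib
import Literature.MathematicalPhysics.QuantumLattice.WilsonDiracAP
import Summits.QuantumFields.QCD.Theorems.QuarksAsStableActionCriticalLineDiamagnetismStubFreeDetFormula

/-!
# The free Bloch blocks: determinant and coercivity of the free Wilson–Dirac operator with
direction-dependent constant phases on the `2⁴`-torus
(helper for crux stmt-QuantumFields-9734, line `Sketch`, stub `stub_freeBlochBlocks`)

What.  For the FREE `r = 1` Wilson–Dirac operator `B = wilsonDirac ρ₃ (fun e => w e.2) m 1` on the
`2⁴`-torus `(ℤ/2)⁴` (colour `Fin 3`, spin `Fin 4`, bare mass `m`) whose link variable in direction `μ`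
is the CONSTANT central phase `w μ = e^{iθ_μ}·1 ∈ U(3)`:
(i) `‖det B‖² = ∏_s h(s)^12` and (ii) `(∀ s, c ≤ h(s)) → c Σ_i ‖v_i‖² ≤ Σ_i ‖(B v)_i‖²`, where
`h(s) = (m + Σ_μ (1 − cos φ_μ))² + Σ_μ sin² φ_μ`, `φ_μ = π·val(s_μ) + θ_μ`, `s ∈ (ℤ/2)⁴`.

How.  The plane waves `χ_k ⊗ e_b ⊗ e_β` diagonalise `B` exactly as in the sibling file
`…WilsonQuarkStabilityStubFreeTwistedFourier` (one common phase); the only change is that the hop in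
direction `μ` picks up `e^{± iθ_μ}`.  On `(ℤ/L)⁴`:
`B (χ_k ⊗ e_b ⊗ e_β) = χ_k ⊗ e_b ⊗ M(k) e_β`, `M(k) = (m + Σ_μ (1 − cos φ_μ))·1 + iΣ_μ sin φ_μ γ_μ`,
`φ_μ = 2π k_μ.val/L + θ_μ` (`wilsonDirac_dirTwist_mul_planeP`: `B P = Q` for the unitary plane-wave
matrix `P = F ⊗ 1`, `F(x,k) = L⁻² χ_k(x)`).  With the Clifford identity `M(k)ᴴ M(k) = h(k)·1`
(`clifford_conjTranspose_mul_self`): (i) is `FreeDetFormula.norm_sq_det_of_planeWave` at `L = 2`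
(`2πv/2 = πv`); (ii) `B = Q Pᴴ` (`P Pᴴ = 1`), `Qᴴ Q = diagonal (h ∘ fst)`
(`symQ_conjTranspose_mul_self_of`), so `Σ‖(Bv)_i‖² = Σ_q h(q.1) ‖(Pᴴv)_q‖² ≥ c Σ‖(Pᴴv)_q‖² = c Σ‖v_i‖²`
(`coercive_of_planeWave`).

References: Montvay–Münster, *Quantum Fields on a Lattice* §4.2 (free Wilson fermions in momentum
space; twisted boundary conditions as constant `U(1)` phases); folklore linear algebra.
Pure theorem file (no `def`s).
-/

noncomputable section

open scoped BigOperators Classical Matrix ComplexConjugate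
open Finset
open Literature.MathematicalPhysics.QuantumLattice Literature.MathematicalPhysics.QuantumFieldTheory
  Literature.Probability.LatticeModels

namespace Summit.QuantumFields.QCD.Cruxes.CriticalLineDiamagnetism.ChessboardCellGain

open scoped Kronecker
open Complex (I)
open Summit.QuantumFields.QCD.Theorems.HeatSlicedQuarks.FreeKernel
open Summit.QuantumFields.QCD.Cruxes.TipNoBinding.PositivityNoLeakSpread
open Summit.QuantumFields.QCD.Cruxes.WilsonQuarkStability.FreeTangentLandauChessboard

namespace FreeBlochBlocks

/-! ### Sums of squares through a matrix with diagonal Gram matrix -/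

/-- If `Qᴴ Q = diagonal d` with `d` real, then `Σ_i ‖(Q u)_i‖² = Σ_q d(q) ‖u_q‖²`. -/
theorem sum_norm_sq_mulVec_of_gram_diagonal {ι : Type*} [Fintype ι] [DecidableEq ι]
    (Q : Matrix ι ι ℂ) (d : ι → ℝ) (hQ : Qᴴ * Q = Matrix.diagonal fun q => ((d q : ℝ) : ℂ))
    (u : ι → ℂ) : ∑ i, ‖(Q *ᵥ u) i‖ ^ 2 = ∑ q, d q * ‖u q‖ ^ 2 := by
  have key : ∀ w : ι → ℂ, ∑ i, ‖w i‖ ^ 2 = (star w ⬝ᵥ w).re := by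
    intro w
    rw [dotProduct, Complex.re_sum]
    refine Finset.sum_congr rfl fun i _ => ?_
    rw [Pi.star_apply, Complex.star_def, ← Complex.normSq_eq_conj_mul_self, Complex.ofReal_re,
      Complex.normSq_eq_norm_sq]
  rw [key, Matrix.star_mulVec, ← Matrix.dotProduct_mulVec, Matrix.mulVec_mulVec, hQ, dotProduct,
    Complex.re_sum]
  refine Finset.sum_congr rfl fun i _ => ?_
  rw [Matrix.mulVec_diagonal, Pi.star_apply, Complex.star_def, mul_left_comm,
    ← Complex.normSq_eq_conj_mul_self, Complex.re_ofReal_mul, Complex.ofReal_re,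
    Complex.normSq_eq_norm_sq]

/-! ### The free Wilson–Dirac operator with direction-dependent constant phases on plane waves -/

variable {L : ℕ} [NeZero L]

/-- **Entrywise action of the free Wilson–Dirac operator with direction-dependent constant central
phases** (`U(x, μ) = w μ = e^{iθ_μ}·1`, `r = 1`, mass `m`):
`(Bψ)(x,a,α) = (m+4)ψ(x,a,α) − ½ Σ_μ Σ_β [(1 − γ_μ)_{αβ} e^{iθ_μ} ψ(x+μ̂,a,β)
+ (1 + γ_μ)_{αβ} e^{−iθ_μ} ψ(x−μ̂,a,β)]` (colour-diagonal since `ρ(w μ) = e^{iθ_μ}·1`). -/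
theorem wilsonDirac_dirTwist_mulVec_apply (θ : Fin 4 → ℝ) (m : ℝ)
    (w : Fin 4 → Matrix.unitaryGroup (Fin 3) ℂ)
    (hw : ∀ μ, (w μ : Matrix (Fin 3) (Fin 3) ℂ) =
      Complex.exp (θ μ * I) • (1 : Matrix (Fin 3) (Fin 3) ℂ))
    (ψ : TorusSite 4 L × Fin 3 × Fin 4 → ℂ) (x : TorusSite 4 L) (a : Fin 3) (α : Fin 4) :
    (wilsonDirac (unitaryFundamentalRep (Fin 3) ℂ) (fun e : Edge 4 L => w e.2) m 1 *ᵥ ψ) (x, a, α) =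
      ((m + 4 : ℝ) : ℂ) * ψ (x, a, α) - (1 / 2) * ∑ μ, ∑ β,
        ((1 - euclideanGamma μ) α β * Complex.exp (θ μ * I) * ψ (x + Pi.single μ 1, a, β) +
          (1 + euclideanGamma μ) α β * Complex.exp (-(θ μ * I)) * ψ (x - Pi.single μ 1, a, β)) := by
  have hf : ∀ μ : Fin 4, ∑ q : TorusSite 4 L × Fin 3 × Fin 4,
      (if q.1 = Literature.MathematicalPhysics.QuantumFieldTheory.Site.shift x μ then
          (1 - euclideanGamma μ) α q.2.2 *
            (Complex.exp (θ μ * I) • (1 : Matrix (Fin 3) (Fin 3) ℂ)) a q.2.1 else 0) * ψ q =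
        ∑ β, (1 - euclideanGamma μ) α β * Complex.exp (θ μ * I) * ψ (x + Pi.single μ 1, a, β) := by
    intro μ
    rw [Fintype.sum_prod_type,
      Finset.sum_eq_single (Literature.MathematicalPhysics.QuantumFieldTheory.Site.shift x μ)]
    · rw [Fintype.sum_prod_type, Finset.sum_eq_single a]
      · simp [Literature.MathematicalPhysics.QuantumFieldTheory.Site.shift]
      · intro b _ hb
        simp [Matrix.one_apply_ne (Ne.symm hb)]
      · simp
    · intro y _ hy
      simp [if_neg hy]
    · simp
  have hb : ∀ μ : Fin 4, ∑ q : TorusSite 4 L × Fin 3 × Fin 4,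
      (if x = Literature.MathematicalPhysics.QuantumFieldTheory.Site.shift q.1 μ then
          (1 + euclideanGamma μ) α q.2.2 *
            (Complex.exp (-(θ μ * I)) • (1 : Matrix (Fin 3) (Fin 3) ℂ)) a q.2.1 else 0) * ψ q =
        ∑ β, (1 + euclideanGamma μ) α β * Complex.exp (-(θ μ * I)) *
          ψ (x - Pi.single μ 1, a, β) := by
    intro μ
    simp_rw [eq_shift_iff]
    rw [Fintype.sum_prod_type, Finset.sum_eq_single (x - Pi.single μ 1)]
    · rw [Fintype.sum_prod_type, Finset.sum_eq_single a]
      · simp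
      · intro b _ hb
        simp [Matrix.one_apply_ne (Ne.symm hb)]
      · simp
    · intro y _ hy
      simp [if_neg hy]
    · simp
  simp only [Matrix.mulVec, dotProduct, wilsonDirac, Matrix.of_apply, unitaryFundamentalRep_apply,
    Matrix.UnitaryGroup.inv_val, hw, star_exp_smul_one, Complex.ofReal_one, one_smul, sub_mul,
    Finset.sum_sub_distrib]
  congr 1
  · rw [Finset.sum_eq_single (x, a, α)]
    · simp
    · intro q _ hq
      rw [if_neg (Ne.symm hq), zero_mul]
    · intro h; exact absurd (Finset.mem_univ _) h
  · simp_rw [Finset.mul_sum, Finset.sum_mul]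
    rw [Finset.sum_comm]
    refine Finset.sum_congr rfl fun μ _ => ?_
    simp_rw [mul_assoc, ← Finset.mul_sum]
    congr 1
    simp_rw [add_mul, Finset.sum_add_distrib, hf, hb, mul_assoc]

/-- **The free operator with direction-dependent phases on a plane wave** (colour `b`, spin `β`,
momentum `k`): `B (χ_k ⊗ e_b ⊗ e_β) = χ_k ⊗ e_b ⊗ M(k) e_β` with the colour–spin symbol
`M(k) = (m + Σ_μ (1 − cos φ_μ))·1 + i Σ_μ sin φ_μ γ_μ`, `φ_μ = 2π k_μ.val / L + θ_μ`. -/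
theorem wilsonDirac_dirTwist_mulVec_planeWave (θ : Fin 4 → ℝ) (m : ℝ)
    (w : Fin 4 → Matrix.unitaryGroup (Fin 3) ℂ)
    (hw : ∀ μ, (w μ : Matrix (Fin 3) (Fin 3) ℂ) =
      Complex.exp (θ μ * I) • (1 : Matrix (Fin 3) (Fin 3) ℂ))
    (k : TorusSite 4 L) (b : Fin 3) (β : Fin 4) :
    wilsonDirac (unitaryFundamentalRep (Fin 3) ℂ) (fun e : Edge 4 L => w e.2) m 1 *ᵥ
        (fun l : TorusSite 4 L × Fin 3 × Fin 4 => torusChar k l.1 * if l.2 = (b, β) then 1 else 0) =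
      fun p => torusChar k p.1 *
        if p.2.1 = b then
          ((((m + ∑ μ, (1 - Real.cos (2 * Real.pi * ((k μ).val : ℝ) / L + θ μ))) : ℝ) : ℂ) •
              (1 : Matrix (Fin 4) (Fin 4) ℂ) +
            I • ∑ μ, ((Real.sin (2 * Real.pi * ((k μ).val : ℝ) / L + θ μ) : ℝ) : ℂ) •
              euclideanGamma μ) p.2.2 β
        else 0 := by
  funext p
  obtain ⟨x, a, α⟩ := p
  rw [wilsonDirac_dirTwist_mulVec_apply θ m w hw]
  dsimp only
  by_cases hab : a = b
  · subst hab
    simp only [Prod.mk.injEq, true_and, if_true, mul_ite, mul_one, mul_zero, Finset.sum_add_distrib,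
      Finset.sum_ite_eq', Finset.mem_univ]
    rw [← Finset.sum_add_distrib,
      Finset.sum_congr rfl fun μ _ => twist_hop_planeWave (θ μ) k x μ α β]
    simp only [Matrix.add_apply, Matrix.smul_apply, smul_eq_mul, Matrix.one_apply, Fin.sum_univ_four]
    push_cast
    split_ifs <;> ring
  · simp only [Prod.mk.injEq, hab, false_and, if_false, mul_zero, add_zero, Finset.sum_const_zero,
      sub_zero]

/-- **`B P = Q`**: on the plane-wave matrix `P = F ⊗ 1`, `F(x,k) = L⁻² χ_k(x)`, the free operator with
direction-dependent constant phases acts by the colour–spin symbol `1 ⊗ M(k)`,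
`M(k) = (m + Σ_μ (1 − cos φ_μ))·1 + i Σ_μ sin φ_μ γ_μ`, `φ_μ = 2π k_μ.val / L + θ_μ`. -/
theorem wilsonDirac_dirTwist_mul_planeP (θ : Fin 4 → ℝ) (m : ℝ)
    (w : Fin 4 → Matrix.unitaryGroup (Fin 3) ℂ)
    (hw : ∀ μ, (w μ : Matrix (Fin 3) (Fin 3) ℂ) =
      Complex.exp (θ μ * I) • (1 : Matrix (Fin 3) (Fin 3) ℂ)) :
    wilsonDirac (unitaryFundamentalRep (Fin 3) ℂ) (fun e : Edge 4 L => w e.2) m 1 *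
        ((Matrix.of fun x k : TorusSite 4 L => ((L : ℂ) ^ 2)⁻¹ * torusChar k x) ⊗ₖ
          (1 : Matrix (Fin 3 × Fin 4) (Fin 3 × Fin 4) ℂ)) =
      Matrix.of fun p q : TorusSite 4 L × Fin 3 × Fin 4 =>
        (Matrix.of fun x k : TorusSite 4 L => ((L : ℂ) ^ 2)⁻¹ * torusChar k x) p.1 q.1 *
          ((1 : Matrix (Fin 3) (Fin 3) ℂ) ⊗ₖ
            ((((m + ∑ μ, (1 - Real.cos (2 * Real.pi * ((q.1 μ).val : ℝ) / L + θ μ))) : ℝ) : ℂ) •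
                (1 : Matrix (Fin 4) (Fin 4) ℂ) +
              I • ∑ μ, ((Real.sin (2 * Real.pi * ((q.1 μ).val : ℝ) / L + θ μ) : ℝ) : ℂ) •
                euclideanGamma μ))
            p.2 q.2 := by
  ext p q
  have hcol : (fun l : TorusSite 4 L × Fin 3 × Fin 4 =>
      ((Matrix.of fun x k : TorusSite 4 L => ((L : ℂ) ^ 2)⁻¹ * torusChar k x) ⊗ₖ
        (1 : Matrix (Fin 3 × Fin 4) (Fin 3 × Fin 4) ℂ)) l q) =
      ((L : ℂ) ^ 2)⁻¹ • fun l => torusChar q.1 l.1 * if l.2 = (q.2.1, q.2.2) then 1 else 0 := by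
    funext l
    rw [Pi.smul_apply, smul_eq_mul, Matrix.kroneckerMap_apply, Matrix.of_apply, Matrix.one_apply,
      Prod.mk.eta, mul_assoc]
  rw [Matrix.mul_apply', dotProduct, show (∑ l, wilsonDirac (unitaryFundamentalRep (Fin 3) ℂ)
      (fun e : Edge 4 L => w e.2) m 1 p l *
      ((Matrix.of fun x k : TorusSite 4 L => ((L : ℂ) ^ 2)⁻¹ * torusChar k x) ⊗ₖ
        (1 : Matrix (Fin 3 × Fin 4) (Fin 3 × Fin 4) ℂ)) l q) =
      (wilsonDirac (unitaryFundamentalRep (Fin 3) ℂ) (fun e : Edge 4 L => w e.2) m 1 *ᵥ fun l =>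
        ((Matrix.of fun x k : TorusSite 4 L => ((L : ℂ) ^ 2)⁻¹ * torusChar k x) ⊗ₖ
        (1 : Matrix (Fin 3 × Fin 4) (Fin 3 × Fin 4) ℂ)) l q) p from rfl,
    hcol, Matrix.mulVec_smul, Pi.smul_apply, wilsonDirac_dirTwist_mulVec_planeWave θ m w hw,
    smul_eq_mul, Matrix.of_apply, Matrix.of_apply, Matrix.kroneckerMap_apply, Matrix.one_apply,
    ite_mul, one_mul, zero_mul, mul_assoc]

/-! ### Coercivity from a plane-wave diagonalisation -/

/-- **Coercivity from a plane-wave diagonalisation.**  If `A P = Q` for the unitary plane-wave matrix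
`P = F ⊗ 1`, `F(x,k) = L⁻² χ_k(x)`, with `Q(p,q) = F(p.1,q.1) · (1 ⊗ N(q.1))(p.2,q.2)` and normalised
spin blocks `N(k)ᴴ N(k) = d(k)·1` (`d` real), then `c ≤ d` on the momentum grid implies
`c Σ_i ‖v_i‖² ≤ Σ_i ‖(A v)_i‖²` (`A = Q Pᴴ`, `Qᴴ Q = diagonal (d ∘ fst)`, `P Pᴴ = 1`). -/
theorem coercive_of_planeWave (N : TorusSite 4 L → Matrix (Fin 4) (Fin 4) ℂ)
    (d : TorusSite 4 L → ℝ)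
    (hN : ∀ k, (N k)ᴴ * N k = ((d k : ℝ) : ℂ) • (1 : Matrix (Fin 4) (Fin 4) ℂ))
    (A : Matrix (TorusSite 4 L × Fin 3 × Fin 4) (TorusSite 4 L × Fin 3 × Fin 4) ℂ)
    (hA : A * ((Matrix.of fun x k : TorusSite 4 L => ((L : ℂ) ^ 2)⁻¹ * torusChar k x) ⊗ₖ
        (1 : Matrix (Fin 3 × Fin 4) (Fin 3 × Fin 4) ℂ)) =
      Matrix.of fun p q : TorusSite 4 L × Fin 3 × Fin 4 =>
        (Matrix.of fun x k : TorusSite 4 L => ((L : ℂ) ^ 2)⁻¹ * torusChar k x) p.1 q.1 *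
          ((1 : Matrix (Fin 3) (Fin 3) ℂ) ⊗ₖ N q.1) p.2 q.2)
    (c : ℝ) (hc : ∀ k, c ≤ d k) (v : TorusSite 4 L × Fin 3 × Fin 4 → ℂ) :
    c * ∑ i, ‖v i‖ ^ 2 ≤ ∑ i, ‖(A *ᵥ v) i‖ ^ 2 := by
  set P : Matrix (TorusSite 4 L × Fin 3 × Fin 4) (TorusSite 4 L × Fin 3 × Fin 4) ℂ :=
    ((Matrix.of fun x k : TorusSite 4 L => ((L : ℂ) ^ 2)⁻¹ * torusChar k x) ⊗ₖ
        (1 : Matrix (Fin 3 × Fin 4) (Fin 3 × Fin 4) ℂ)) with hP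
  have hd : (A * P)ᴴ * (A * P) =
      Matrix.diagonal fun q : TorusSite 4 L × Fin 3 × Fin 4 => ((d q.1 : ℝ) : ℂ) := by
    rw [hA]; exact symQ_conjTranspose_mul_self_of N d hN
  have hPu : Pᴴ * P = 1 := by rw [hP]; exact planeP_conjTranspose_mul_self
  have hPP : P * Pᴴ = 1 := mul_eq_one_comm.1 hPu
  have hAv : A *ᵥ v = (A * P) *ᵥ (Pᴴ *ᵥ v) := by
    rw [Matrix.mulVec_mulVec, Matrix.mul_assoc, hPP, Matrix.mul_one]
  have h1 : ∑ i, ‖((A * P) *ᵥ (Pᴴ *ᵥ v)) i‖ ^ 2 = ∑ q, d q.1 * ‖(Pᴴ *ᵥ v) q‖ ^ 2 :=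
    sum_norm_sq_mulVec_of_gram_diagonal (A * P) (fun q => d q.1) hd _
  have h2 : ∑ q, ‖(Pᴴ *ᵥ v) q‖ ^ 2 = ∑ i, ‖v i‖ ^ 2 := by
    rw [sum_norm_sq_mulVec_of_conjTranspose_mul_self Pᴴ 1
      (by rw [Matrix.conjTranspose_conjTranspose, hPP, Complex.ofReal_one, one_smul]) v, one_mul]
  rw [hAv, h1, ← h2, Finset.mul_sum]
  exact Finset.sum_le_sum fun q _ => mul_le_mul_of_nonneg_right (hc q.1) (sq_nonneg _)

end FreeBlochBlocks

open FreeBlochBlocks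

/-- **The free Bloch blocks** (stub `stub_freeBlochBlocks`): for the free `r = 1` Wilson–Dirac
operator `B` on the `2⁴`-torus with the constant central direction-dependent phases
`w μ = e^{iθ_μ}·1 ∈ U(3)` on the `μ`-links and bare mass `m`, with
`h(s) = (m + Σ_μ (1 − cos(π val s_μ + θ_μ)))² + Σ_μ sin²(π val s_μ + θ_μ)`, `s ∈ (ℤ/2)⁴`:
(i) `‖det B‖² = ∏_s h(s)^12`; (ii) if `c ≤ h` then `c Σ_i ‖v_i‖² ≤ Σ_i ‖(B v)_i‖²`
(plane-wave diagonalisation, `B P = Q`, `Qᴴ Q = diagonal (h ∘ fst)`, `P` unitary). -/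
theorem stub_freeBlochBlocks :
    ∀ (θ : Fin 4 → ℝ) (m : ℝ) (w : Fin 4 → Matrix.unitaryGroup (Fin 3) ℂ),
      (∀ μ, ((w μ : Matrix.unitaryGroup (Fin 3) ℂ) : Matrix (Fin 3) (Fin 3) ℂ) =
        Complex.exp (θ μ * Complex.I) • (1 : Matrix (Fin 3) (Fin 3) ℂ)) →
      let B := wilsonDirac (unitaryFundamentalRep (Fin 3) ℂ) (fun e : Edge 4 2 => w e.2) m 1;
      let h : (Fin 4 → ZMod 2) → ℝ := fun s =>
        (m + ∑ μ : Fin 4, (1 - Real.cos (Real.pi * ((s μ).val : ℝ) + θ μ))) ^ 2 +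
          ∑ μ : Fin 4, Real.sin (Real.pi * ((s μ).val : ℝ) + θ μ) ^ 2;
      ‖B.det‖ ^ 2 = ∏ s : Fin 4 → ZMod 2, h s ^ 12 ∧
        ∀ (c : ℝ), (∀ s, c ≤ h s) → ∀ v : TorusSite 4 2 × Fin 3 × Fin 4 → ℂ,
          c * ∑ i, ‖v i‖ ^ 2 ≤ ∑ i, ‖(B.mulVec v) i‖ ^ 2 := by
  intro θ m w hw
  dsimp only
  -- the angles at `L = 2`: `2π v / 2 + t = π v + t`
  have hθ : ∀ v t : ℝ, 2 * Real.pi * v / ((2 : ℕ) : ℝ) + t = Real.pi * v + t := fun v t => by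
    push_cast
    ring
  -- `B P = Q` with the symbol at the angles `π val s_μ + θ_μ`
  have hA := wilsonDirac_dirTwist_mul_planeP (L := 2) θ m w hw
  simp only [hθ] at hA
  -- Clifford: `N(s)ᴴ N(s) = h(s)·1`
  have hN : ∀ s : TorusSite 4 2,
      ((((m + ∑ μ, (1 - Real.cos (Real.pi * ((s μ).val : ℝ) + θ μ))) : ℝ) : ℂ) •
            (1 : Matrix (Fin 4) (Fin 4) ℂ) +
          I • ∑ μ, ((Real.sin (Real.pi * ((s μ).val : ℝ) + θ μ) : ℝ) : ℂ) • euclideanGamma μ)ᴴ *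
        ((((m + ∑ μ, (1 - Real.cos (Real.pi * ((s μ).val : ℝ) + θ μ))) : ℝ) : ℂ) •
            (1 : Matrix (Fin 4) (Fin 4) ℂ) +
          I • ∑ μ, ((Real.sin (Real.pi * ((s μ).val : ℝ) + θ μ) : ℝ) : ℂ) • euclideanGamma μ) =
      (((m + ∑ μ, (1 - Real.cos (Real.pi * ((s μ).val : ℝ) + θ μ))) ^ 2 +
          ∑ μ, Real.sin (Real.pi * ((s μ).val : ℝ) + θ μ) ^ 2 : ℝ) : ℂ) •
        (1 : Matrix (Fin 4) (Fin 4) ℂ) :=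
    fun s => clifford_conjTranspose_mul_self _ _
  exact ⟨FreeDetFormula.norm_sq_det_of_planeWave _ _ hN _ hA,
    fun c hc v => coercive_of_planeWave _ _ hN _ hA c hc v⟩

end Summit.QuantumFields.QCD.Cruxes.CriticalLineDiamagnetism.ChessboardCellGain

end
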